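import Mathlib
import Summits.Ventures.PercRepro2.Defs
import Summits.Ventures.PercRepro2.Graph
import Summits.Ventures.PercRepro2.Events
import Summits.Ventures.PercRepro2.CycleDefs
import Summits.Ventures.PercRepro2.CycleTerm
import Summits.Ventures.PercRepro2.CycleDecode

/-!
# The antipodal 2-colouring inequality on a cycle: the counting core (blind cell PercRepro2, mine-a g47)

**Theorem `sum_wt_nonneg`**: for a set `D` of positions of the cycle, up-sets `𝓤 𝓥` of vertex
sets and a vertex `h` strictly inside the hull of `D` (`min D < h ≤ max D`),

  `Σ_{τ ⊆ D} 1[h ∈ arc τ] · (1[arc τ ∈ 𝓤] − 1[arc (D∖τ) ∈ 𝓤]) · (1[arc τ ∈ 𝓥] − 1[arc (D∖τ) ∈ 𝓥]) ≥ 0`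

— the antipodal base case (K₀⁰) of the lane's three-event inequality (T_h) on every minor of a
cycle (MINE-A.md §102.2, proofs/MINEA-CYCLE.md).  Proof: the sum is `#{wt = 1} − #{wt = −1}`
(`CycleTerm.sum_wt_eq_card_sub_card`) and `phi` injects the negative colourings into the positive
ones: a negative colouring is red at exactly one extreme position of `D`; flipping its red initial
(or final) segment gives the colouring with red hull `[f, l]`, whose arc `V ∖ (f, l]` is the union
of the two one-sided arcs and hence lies in both families, while an initial (final) segment maps
to its single last (first) red edge, whose arc is everything; `psi` decodes every image
(`phi_spec_min`, `phi_spec_max`), so `phi` is injective on the negative colourings.  The case of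
`h` outside the hull of `D` is the antipodal Harris form and is handled in the assembly.  No
instance, no notation.
-/

namespace Summit.Ventures.PercRepro2

namespace TCycle

open Finset

variable {n : ℕ}

/-! ## `phi` maps negative colourings to positive ones and is decoded by `psi` -/

section Main

variable {D : Finset (Fin (n + 1))} (hD : D.Nonempty) {h : Fin (n + 1)}
  {𝓤 𝓥 : Set (Set (Fin (n + 1)))}

/-- **Red at the minimum**: the image is positive and decodes back. -/
lemma phi_spec_min (hU : IsUpperSet 𝓤) (hV : IsUpperSet 𝓥) (hh0 : D.min' hD < h)
    {τ : Finset (Fin (n + 1))} (hτ : τ ⊆ D) (h0 : D.min' hD ∈ τ) (h1 : D.max' hD ∉ τ)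
    (hw : wt D h 𝓤 𝓥 τ = -1) :
    phi D hD τ ⊆ D ∧ wt D h 𝓤 𝓥 (phi D hD τ) = 1 ∧ psi D h (phi D hD τ) = τ := by
  obtain ⟨hlh, h0l, hl1, h0f, hWU, hWV⟩ := neg_min_spec hD hU hV hh0 hτ h0 h1 hw
  obtain ⟨hDU, hDV, hunivU, hunivV⟩ := arc_D_notMem_of_neg hU hV hτ hw
  set l := τ.max' ⟨_, h0⟩ with hl
  set f := (D \ τ).min' ⟨_, mem_sdiff.2 ⟨D.max'_mem hD, h1⟩⟩ with hf
  have hlτ : l ∈ τ := τ.max'_mem _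
  have hmax : ∀ x ∈ τ, x ≤ l := fun x hx => τ.le_max' x hx
  have hfD : f ∈ D \ τ := (D \ τ).min'_mem _
  have hfτ : f ∉ τ := (mem_sdiff.1 hfD).2
  have hfmin : ∀ x ∈ D \ τ, f ≤ x := fun x hx => (D \ τ).min'_le x hx
  rw [phi_eq_of_min D hD h0 h1]
  by_cases hfl : f < l
  · rw [if_pos hfl]
    have hsub : flipLow τ f ⊆ D := flipLow_subset D hτ (mem_sdiff.1 hfD).1
    have h0' : D.min' hD ∉ flipLow τ f := by
      rw [mem_flipLow]
      rintro (heq | ⟨_, hlt⟩)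
      · exact absurd heq h0f.ne
      · exact absurd hlt (not_lt.2 h0f.le)
    have h1' : D.max' hD ∉ flipLow τ f := by
      rw [mem_flipLow]
      rintro (heq | ⟨hmem, _⟩)
      · exact absurd (heq ▸ lt_trans hfl hl1) (lt_irrefl _)
      · exact h1 hmem
    have harcI : arc (flipLow τ f) = {v | v ≤ f ∨ l < v} := arc_flipLow hlτ hmax hfl
    have harcI' : arc (D \ flipLow τ f) = arc D := arc_sdiff_of_neither D hD h0' h1'
    refine ⟨hsub, ?_, ?_⟩
    · apply wt_eq_one_of
      · rw [harcI]; exact Or.inr hlh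
      · rw [harcI]; exact hWU
      · rw [harcI]; exact hWV
      · rw [harcI']; exact hDU
      · rw [harcI']; exact hDV
    · have hne : (flipLow τ f).Nonempty := ⟨f, mem_flipLow.2 (Or.inl rfl)⟩
      have hmin' := min'_flipLow (τ := τ) (f := f) hne
      have hmax' := max'_flipLow hlτ hmax hfl hne
      rw [psi_of_ne D h hne (by rw [hmin', hmax']; exact hfl.ne), if_pos (by rw [hmax']; exact hlh),
        hmin']
      ext x
      simp only [mem_union, mem_sdiff, mem_flipLow, mem_singleton, mem_filter]
      constructor
      · rintro (⟨hx | ⟨hx, _⟩, hne'⟩ | ⟨hxD, hxf⟩)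
        · exact absurd hx hne'
        · exact hx
        · by_contra hxτ
          exact absurd (hfmin x (mem_sdiff.2 ⟨hxD, hxτ⟩)) (not_le.2 hxf)
      · intro hx
        have hxf : x ≠ f := fun heq => hfτ (heq ▸ hx)
        rcases lt_or_gt_of_ne hxf with hlt | hgt
        · exact Or.inr ⟨hτ hx, hlt⟩
        · exact Or.inl ⟨Or.inr ⟨hx, hgt⟩, hxf⟩
  · rw [if_neg hfl]
    have hlf : l < f := lt_of_le_of_ne (not_lt.1 hfl) fun heq => hfτ (heq ▸ hlτ)
    have hsub : ({l} : Finset (Fin (n + 1))) ⊆ D := singleton_subset_iff.2 (hτ hlτ)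
    have h0' : D.min' hD ∉ ({l} : Finset (Fin (n + 1))) := by
      rw [mem_singleton]; exact h0l.ne
    have h1' : D.max' hD ∉ ({l} : Finset (Fin (n + 1))) := by
      rw [mem_singleton]; exact hl1.ne'
    have harcI' : arc (D \ {l}) = arc D := arc_sdiff_of_neither D hD h0' h1'
    refine ⟨hsub, ?_, ?_⟩
    · apply wt_eq_one_of
      · rw [arc_singleton]; exact Set.mem_univ _
      · rw [arc_singleton]; exact hunivU
      · rw [arc_singleton]; exact hunivV
      · rw [harcI']; exact hDU
      · rw [harcI']; exact hDV
    · rw [psi_singleton, if_pos hlh]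
      ext x
      simp only [mem_filter]
      constructor
      · rintro ⟨hxD, hxl⟩
        by_contra hxτ
        exact absurd (le_trans (hfmin x (mem_sdiff.2 ⟨hxD, hxτ⟩)) hxl) (not_le.2 hlf)
      · intro hx
        exact ⟨hτ hx, hmax x hx⟩

/-- **Red at the maximum**: the image is positive and decodes back. -/
lemma phi_spec_max (hU : IsUpperSet 𝓤) (hV : IsUpperSet 𝓥) (hh1 : h ≤ D.max' hD)
    {τ : Finset (Fin (n + 1))} (hτ : τ ⊆ D) (h0 : D.min' hD ∉ τ) (h1 : D.max' hD ∈ τ)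
    (hw : wt D h 𝓤 𝓥 τ = -1) :
    phi D hD τ ⊆ D ∧ wt D h 𝓤 𝓥 (phi D hD τ) = 1 ∧ psi D h (phi D hD τ) = τ := by
  obtain ⟨hhf, h0f, hf1, hl1, hWU, hWV⟩ := neg_max_spec hD hU hV hh1 hτ h0 h1 hw
  obtain ⟨hDU, hDV, hunivU, hunivV⟩ := arc_D_notMem_of_neg hU hV hτ hw
  set f := τ.min' ⟨_, h1⟩ with hf
  set l := (D \ τ).max' ⟨_, mem_sdiff.2 ⟨D.min'_mem hD, h0⟩⟩ with hl
  have hfτ : f ∈ τ := τ.min'_mem _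
  have hmin : ∀ x ∈ τ, f ≤ x := fun x hx => τ.min'_le x hx
  have hlD : l ∈ D \ τ := (D \ τ).max'_mem _
  have hlτ : l ∉ τ := (mem_sdiff.1 hlD).2
  have hlmax : ∀ x ∈ D \ τ, x ≤ l := fun x hx => (D \ τ).le_max' x hx
  rw [phi_eq_of_max D hD h0 h1]
  by_cases hfl : f < l
  · rw [if_pos hfl]
    have hsub : flipHigh τ l ⊆ D := flipHigh_subset D hτ (mem_sdiff.1 hlD).1
    have h0' : D.min' hD ∉ flipHigh τ l := by
      rw [mem_flipHigh]
      rintro (heq | ⟨hmem, _⟩)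
      · exact absurd (heq ▸ lt_trans h0f hfl) (lt_irrefl _)
      · exact h0 hmem
    have h1' : D.max' hD ∉ flipHigh τ l := by
      rw [mem_flipHigh]
      rintro (heq | ⟨_, hlt⟩)
      · exact absurd heq hl1.ne'
      · exact absurd hlt (not_lt.2 hl1.le)
    have harcI : arc (flipHigh τ l) = {v | v ≤ f ∨ l < v} := arc_flipHigh hfτ hmin hfl
    have harcI' : arc (D \ flipHigh τ l) = arc D := arc_sdiff_of_neither D hD h0' h1'
    refine ⟨hsub, ?_, ?_⟩
    · apply wt_eq_one_of
      · rw [harcI]; exact Or.inl hhf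
      · rw [harcI]; exact hWU
      · rw [harcI]; exact hWV
      · rw [harcI']; exact hDU
      · rw [harcI']; exact hDV
    · have hne : (flipHigh τ l).Nonempty := ⟨l, mem_flipHigh.2 (Or.inl rfl)⟩
      have hmax' := max'_flipHigh (τ := τ) (l := l) hne
      have hmin' := min'_flipHigh hfτ hmin hfl hne
      rw [psi_of_ne D h hne (by rw [hmin', hmax']; exact hfl.ne),
        if_neg (by rw [hmax']; exact not_lt.2 (le_trans hhf hfl.le)), hmax']
      ext x
      simp only [mem_union, mem_sdiff, mem_flipHigh, mem_singleton, mem_filter]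
      constructor
      · rintro (⟨hx | ⟨hx, _⟩, hne'⟩ | ⟨hxD, hxl⟩)
        · exact absurd hx hne'
        · exact hx
        · by_contra hxτ
          exact absurd (hlmax x (mem_sdiff.2 ⟨hxD, hxτ⟩)) (not_le.2 hxl)
      · intro hx
        have hxl : x ≠ l := fun heq => hlτ (heq ▸ hx)
        rcases lt_or_gt_of_ne hxl with hlt | hgt
        · exact Or.inl ⟨Or.inr ⟨hx, hlt⟩, hxl⟩
        · exact Or.inr ⟨hτ hx, hgt⟩
  · rw [if_neg hfl]
    have hlf : l < f := lt_of_le_of_ne (not_lt.1 hfl) fun heq => hlτ (heq ▸ hfτ)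
    have hsub : ({f} : Finset (Fin (n + 1))) ⊆ D := singleton_subset_iff.2 (hτ hfτ)
    have h0' : D.min' hD ∉ ({f} : Finset (Fin (n + 1))) := by
      rw [mem_singleton]; exact h0f.ne
    have h1' : D.max' hD ∉ ({f} : Finset (Fin (n + 1))) := by
      rw [mem_singleton]; exact hf1.ne'
    have harcI' : arc (D \ {f}) = arc D := arc_sdiff_of_neither D hD h0' h1'
    refine ⟨hsub, ?_, ?_⟩
    · apply wt_eq_one_of
      · rw [arc_singleton]; exact Set.mem_univ _
      · rw [arc_singleton]; exact hunivU
      · rw [arc_singleton]; exact hunivV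
      · rw [harcI']; exact hDU
      · rw [harcI']; exact hDV
    · rw [psi_singleton, if_neg (not_lt.2 hhf)]
      ext x
      simp only [mem_filter]
      constructor
      · rintro ⟨hxD, hfx⟩
        by_contra hxτ
        exact absurd (le_trans hfx (hlmax x (mem_sdiff.2 ⟨hxD, hxτ⟩))) (not_le.2 hlf)
      · intro hx
        exact ⟨hτ hx, hmin x hx⟩

/-- `phi` maps every negative colouring to a positive one, and `psi` decodes it. -/
lemma phi_spec (hU : IsUpperSet 𝓤) (hV : IsUpperSet 𝓥) (hh0 : D.min' hD < h)
    (hh1 : h ≤ D.max' hD) {τ : Finset (Fin (n + 1))} (hτ : τ ∈ negSet D h 𝓤 𝓥) :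
    phi D hD τ ∈ posSet D h 𝓤 𝓥 ∧ psi D h (phi D hD τ) = τ := by
  rw [negSet, mem_filter, mem_powerset] at hτ
  obtain ⟨hτD, hw⟩ := hτ
  have hnb := not_both_of_neg hD hU hV hτD hw
  have hnn := not_neither_of_neg hD hU hV hτD hw
  by_cases h0 : D.min' hD ∈ τ
  · have h1 : D.max' hD ∉ τ := fun h1 => hnb ⟨h0, h1⟩
    obtain ⟨hsub, hw', hpsi⟩ := phi_spec_min hD hU hV hh0 hτD h0 h1 hw
    exact ⟨by rw [posSet, mem_filter, mem_powerset]; exact ⟨hsub, hw'⟩, hpsi⟩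
  · have h1 : D.max' hD ∈ τ := by
      by_contra h1
      exact hnn ⟨h0, h1⟩
    obtain ⟨hsub, hw', hpsi⟩ := phi_spec_max hD hU hV hh1 hτD h0 h1 hw
    exact ⟨by rw [posSet, mem_filter, mem_powerset]; exact ⟨hsub, hw'⟩, hpsi⟩

/-- **The counting core**: for `h` strictly inside the hull of `D` and up-sets `𝓤 𝓥`, the antipodal
2-colouring sum over the subsets of `D` is nonnegative. -/
theorem sum_wt_nonneg (hU : IsUpperSet 𝓤) (hV : IsUpperSet 𝓥) (hh0 : D.min' hD < h)
    (hh1 : h ≤ D.max' hD) : 0 ≤ ∑ τ ∈ D.powerset, wt D h 𝓤 𝓥 τ := by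
  rw [sum_wt_eq_card_sub_card, sub_nonneg]
  have hcard : (negSet D h 𝓤 𝓥).card ≤ (posSet D h 𝓤 𝓥).card := by
    refine card_le_card_of_injOn (phi D hD) (fun τ hτ => (phi_spec hD hU hV hh0 hh1 hτ).1) ?_
    intro τ hτ τ' hτ' heq
    have h1 := (phi_spec hD hU hV hh0 hh1 hτ).2
    have h2 := (phi_spec hD hU hV hh0 hh1 hτ').2
    rw [← h1, ← h2, heq]
  exact_mod_cast hcard

end Main

end TCycle

end Summit.Ventures.PercRepro2
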